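import Summits.HodgeConjecture.FermatCycles.ShiodaConditionFourfoldNormalized
import Literature.AlgebraicGeometry.Shioda1979.Statement
import HarnessLib

/-!
# Shioda's stable-generation condition `(Q⁴ₘ)` by kernel exhaustion with certificates — the search

HONEST FRAMING: explicit algebraic cycles for specific Hodge classes on Fermat/Delsarte varieties;
residual open instances listed; no claim on general Hodge.

Topic path `Summits/HodgeConjecture/FermatCycles/` of cell `pub-hfermat` (new work, not literature). Companion of
`ShiodaConditionFourfold.lean` / `…Normalized.lean` (the cell's kernel searches for Shioda's condition `(P⁴ₘ)`).

THE CONDITION. Shioda, Math. Ann. **245** (1979) §4 p. 183, weakens `(Pⁿₘ)` to the STABLE-GENERATION condition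
`(Qⁿₘ)`: every element `ξ` of `Mₘ(y)`, `3 ≤ y ≤ n/2+1`, is `ξ = ξ₁ − ξ₂` with `ξ₁, ξ₂ ∈ M'ₘ`, the sub-semigroup generated by
`Mₘ(1)` (pairs `{a, −a}`), `Mₘ(2)` (Hodge `4`-multisets = Hodge classes of the Fermat surface) and `Mₘ(3)^{sd}` (semi-decomposable
sextuples); his Claim (p. 183, with Lemmas 2–3) replaces `(P)` by `(Q)` in Theorem III (`(Qⁿₘ) ⇒` the Hodge conjecture for `Xⁿₘ`),
and p. 184 says: "we do not know any value of `m` which satisfies `(Qₘ)` but not `(Pₘ)`". The tree carries `(Qⁿₘ)` verbatim as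
`Literature.AlgebraicGeometry.Shioda1979.ConditionQ m n` (with `M'ₘ = Shioda1979.MPrime m`, generators `Shioda1979.primeGenerators m`)
and the arithmetic spine of the Claim as `Shioda1979.forall_of_conditionQ`.

WHAT IS HERE (generic in the level `N`; the certificates for particular `N` are the sibling files `ConditionQFourfold<Level>.lean`):

* `genB` / `certB` / `lookupB`: Boolean checks that a list of representatives is one of Shioda's generators of `M'_N`, that a
  CERTIFICATE `(X, Y)` — two lists of generators — witnesses `s + ΣX = ΣY` for an explicit sextuple `s`, and a table lookup keyed
  by the sorted representatives; soundness `mem_primeGenerators_of_genB`, `stably_of_certB`, `stably_of_lookupB`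
  (conclusion: `∃ ξ₁ ∈ M'_N, ∃ ξ₂ ∈ M'_N, s + ξ₂ = ξ₁`, "`s` is stably in `M'_N`");
* `stably_of_witness`: each of the three `(P)`-witnesses of `ShiodaConditionFourfold` (`HasPair`, `semiB`, `quasiB`) already puts a
  Hodge sextuple stably in `M'_N` (pair + Hodge `4`-set; a generator; `s + {c, −c} = (P ∗ c) + (P' ∗ (−c))`) — Shioda's "obvious
  implication `(P) ⇒ (Q)`" at length `3`, pointwise;
* the unit-normalised SEARCHES `checkQU N T b₀ len` (sextuples containing `1`) and `checkQN N T a₀ len` (sextuples of non-units,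
  chunked by the first representative), per-tuple test `restB6 ∨ lookupB` on the Hodge survivors, with their unpacking lemmas and the
  sorted-form soundness `qU_of_chunks`, `qN_of_chunks`; `map_unit_mem_mPrime` / `stably_map_unit` (the unit group preserves `M'_N`).
  The invariant form `conditionQ_four_of_normalized : … → ConditionQ N 4` is in `ConditionQFourfoldSearch.lean`.

No definition of a `Prop`, no named fact; every statement is proved. Nothing here asserts the Hodge conjecture for any `Xⁿₘ`.

References: [Shioda1979HodgeFermat] T. Shioda, Math. Ann. 245 (1979) 175–184, §4 p. 183 (`M'ₘ`, `(Qⁿₘ)`, Lemmas 1–3, Claim), p. 184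
(the question); [Shioda1979PJA] T. Shioda, Proc. Japan Acad. 55A (1979) §1 (eqs. (2)–(3), Definition (i)–(iii));
[daSilva2021HodgeFermat] G. da Silva Jr., Experimental Results 2 (2021) e22, Def. 2.4. Cell files: `pub-hfermat-enum/P4-TABLE.md`
§(Q⁴ₘ), `data/shioda_Q4_m3-100.json` (implementation 1, integer echelon), `code/lit/q4/q4norm.py` (implementation 2, this seat).
-/

namespace Summit.HodgeConjecture.FermatCycles.ConditionQFourfold

open Multiset
open Literature.AlgebraicGeometry.HodgeTheory Literature.AlgebraicGeometry.HodgeTheory.FermatCharacter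
open Literature.AlgebraicGeometry.Shioda1982 Literature.AlgebraicGeometry.Shioda1979
open Summit.HodgeConjecture.FermatCycles.ShiodaConditionFourfold

/-! ### Generators of `M'_N` and certificates, as Booleans on representatives -/

/-- The multiset over `ℤ/N` of a list of representatives. [folklore] -/
def msOf (N : ℕ) (l : List ℕ) : Multiset (ZMod N) := ((l.map fun n : ℕ ↦ (n : ZMod N) : List (ZMod N)) : Multiset (ZMod N))

/-- `genB N l`: the representatives `l` form one of Shioda's generators of `M'_N` — a Hodge multiset of cardinality `2` (a pair),
`4` (a Hodge class of the Fermat surface) or `6` and semi-decomposable. [cite: Shioda1979HodgeFermat, §4, p. 183 (definition of M'ₘ)] -/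
def genB (N : ℕ) (l : List ℕ) : Bool :=
  hodgeUB N (msOf N l) && (l.length == 2 || l.length == 4 || (l.length == 6 && semiB (msOf N l)))

/-- The sum of the multisets of a list of representative lists. [folklore] -/
def sumOf (N : ℕ) (L : List (List ℕ)) : Multiset (ZMod N) := (L.map (msOf N)).sum

/-- `certB N X Y s`: every member of `X` and of `Y` is a generator of `M'_N` and `s + ΣX = ΣY` — a certificate that `s` is
stably in `M'_N` (`s = ξ₁ − ξ₂`, `ξ₁ = ΣY`, `ξ₂ = ΣX`). [cite: Shioda1979HodgeFermat, §4 condition (Qⁿₘ), p. 183] -/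
def certB (N : ℕ) (X Y : List (List ℕ)) (s : Multiset (ZMod N)) : Bool :=
  X.all (genB N) && Y.all (genB N) && decide (s + sumOf N X = sumOf N Y)

/-- Table lookup: an entry `(key, X, Y)` whose key is the list of the first five sorted representatives and whose certificate
passes on `sext N a b c d e`. [folklore] -/
def lookupB (N : ℕ) (T : List (List ℕ × List (List ℕ) × List (List ℕ))) (a b c d e : ℕ) : Bool :=
  T.any fun ent ↦ ent.1 == [a, b, c, d, e] && certB N ent.2.1 ent.2.2 (sext N a b c d e)

/-- The per-tuple test of the `(Q)`-search: a `(P)`-witness (`restB6`) or a table certificate. [cite: Shioda1979HodgeFermat, §4, p. 183] -/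
def qtestB (N : ℕ) (T : List (List ℕ × List (List ℕ) × List (List ℕ))) (a b c d e : ℕ) : Bool :=
  restB6 N a b c d e || lookupB N T a b c d e

/-! ### Soundness of the certificates -/

/-- `sumOf` of a cons. [folklore] -/
theorem sumOf_cons (N : ℕ) (l : List ℕ) (L : List (List ℕ)) : sumOf N (l :: L) = msOf N l + sumOf N L := by
  simp [sumOf]

/-- A list passing `genB` is a generator of `M'_N`. [cite: Shioda1979HodgeFermat, §4, p. 183 (definition of M'ₘ)] -/
theorem mem_primeGenerators_of_genB {N : ℕ} [NeZero N] {l : List ℕ} (h : genB N l = true) :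
    msOf N l ∈ primeGenerators N := by
  unfold genB at h
  simp only [Bool.and_eq_true, Bool.or_eq_true, beq_iff_eq] at h
  obtain ⟨hH, hlen⟩ := h
  have hcard : card (msOf N l) = l.length := by simp [msOf]
  refine ⟨isHodgeMultiset_of_hodgeUB hH, ?_⟩
  rcases hlen with (h2 | h4) | ⟨h6, hsd⟩
  · exact Or.inl (by rw [hcard, h2])
  · exact Or.inr (Or.inl (by rw [hcard, h4]))
  · have h6' : card (msOf N l) = 6 := by rw [hcard, h6]
    exact Or.inr (Or.inr ⟨h6', isSemiDecomposable_of_semiB h6' hsd⟩)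

/-- A list of generators sums to an element of `M'_N`. [cite: Shioda1979HodgeFermat, §4, p. 183] -/
theorem sumOf_mem_mPrime {N : ℕ} [NeZero N] {L : List (List ℕ)} (h : L.all (genB N) = true) : sumOf N L ∈ MPrime N := by
  induction L with
  | nil => simp [sumOf]
  | cons l L ih =>
    simp only [List.all_cons, Bool.and_eq_true] at h
    rw [sumOf_cons]
    exact (MPrime N).add_mem (mem_mPrime_of_mem (mem_primeGenerators_of_genB h.1)) (ih h.2)

/-- **Soundness of a certificate**: `certB N X Y s` puts `s` stably in `M'_N`. [cite: Shioda1979HodgeFermat, §4 condition (Qⁿₘ), p. 183] -/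
theorem stably_of_certB {N : ℕ} [NeZero N] {X Y : List (List ℕ)} {s : Multiset (ZMod N)} (h : certB N X Y s = true) :
    ∃ ξ₁ ∈ MPrime N, ∃ ξ₂ ∈ MPrime N, s + ξ₂ = ξ₁ := by
  unfold certB at h
  simp only [Bool.and_eq_true, decide_eq_true_eq] at h
  obtain ⟨⟨hX, hY⟩, hEq⟩ := h
  exact ⟨sumOf N Y, sumOf_mem_mPrime hY, sumOf N X, sumOf_mem_mPrime hX, hEq⟩

/-- **Soundness of the table lookup.** [folklore] -/
theorem stably_of_lookupB {N : ℕ} [NeZero N] {T : List (List ℕ × List (List ℕ) × List (List ℕ))} {a b c d e : ℕ}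
    (h : lookupB N T a b c d e = true) : ∃ ξ₁ ∈ MPrime N, ∃ ξ₂ ∈ MPrime N, sext N a b c d e + ξ₂ = ξ₁ := by
  unfold lookupB at h
  obtain ⟨ent, -, hent⟩ := List.any_eq_true.mp h
  simp only [Bool.and_eq_true] at hent
  exact stably_of_certB hent.2

/-! ### `(P) ⇒ (Q)` pointwise at length `3`: each `(P)`-witness puts a Hodge sextuple stably in `M'_N` -/

/-- A decomposable Hodge sextuple is a pair plus a Hodge `4`-set (or three pairs…): in any case a sum of two generators, so it lies
in `M'_N`. [cite: Shioda1979HodgeFermat, §4, p. 183 ("obvious implications")] -/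
theorem mem_mPrime_of_isDecomposable {N : ℕ} [NeZero N] {s : Multiset (ZMod N)} (h6 : card s = 6) (h : IsDecomposable s) :
    s ∈ MPrime N := by
  obtain ⟨t, u, ht0, hu0, ht, hu, rfl⟩ := h
  have hct := ht.two_le_card ht0
  have hcu := hu.two_le_card hu0
  obtain ⟨k, hk⟩ := ht.even_card
  obtain ⟨l, hl⟩ := hu.even_card
  rw [Multiset.card_add] at h6
  have hgt : t ∈ primeGenerators N := ⟨ht, by omega⟩
  have hgu : u ∈ primeGenerators N := ⟨hu, by omega⟩
  exact (MPrime N).add_mem (mem_mPrime_of_mem hgt) (mem_mPrime_of_mem hgu)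

/-- **Each `(P)`-witness gives `(Q)` for the sextuple**: a pair (decomposable ⇒ `s ∈ M'_N`), two zero-sum triples (`s` is a
generator), or a `3 + 3` quasi split (`s + {c, −c} = (P ∗ c) + (P' ∗ (−c))`, two Hodge `4`-sets and a pair).
[cite: Shioda1979HodgeFermat, §4, p. 183 ("(Pⁿₘ) ⇒ (Qⁿₘ)")] -/
theorem stably_of_witness {N : ℕ} [NeZero N] {s : Multiset (ZMod N)} (hs : IsHodgeMultiset s) (h6 : card s = 6)
    (h : (decide (HasPair s) || semiB s || quasiB N s) = true) : ∃ ξ₁ ∈ MPrime N, ∃ ξ₂ ∈ MPrime N, s + ξ₂ = ξ₁ := by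
  simp only [Bool.or_eq_true, decide_eq_true_eq] at h
  rcases h with (hP | hS) | hQ
  · exact ⟨s, mem_mPrime_of_isDecomposable h6 (isDecomposable_of_hasPair hs h6 hP), 0, (MPrime N).zero_mem, by simp⟩
  · exact ⟨s, mem_mPrime_of_mem ⟨hs, Or.inr (Or.inr ⟨h6, isSemiDecomposable_of_semiB h6 hS⟩)⟩, 0, (MPrime N).zero_mem, by simp⟩
  · obtain ⟨t, ht, hne, hT', hU'⟩ := of_decide_eq_true hQ
    rw [mem_powersetCard] at ht
    have hT := isHodgeMultiset_of_hodgeUB hT'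
    have hU := isHodgeMultiset_of_hodgeUB hU'
    have hcardU : card (t.sum ::ₘ (s - t)) = 4 := by rw [card_cons, card_sub ht.1, h6, ht.2]
    have hcardT : card ((-t.sum) ::ₘ t) = 4 := by rw [card_cons, ht.2]
    refine ⟨(-t.sum) ::ₘ t + (t.sum ::ₘ (s - t)),
      (MPrime N).add_mem (mem_mPrime_of_mem ⟨hT, Or.inr (Or.inl hcardT)⟩) (mem_mPrime_of_mem ⟨hU, Or.inr (Or.inl hcardU)⟩),
      {-t.sum, -(-t.sum)}, pair_mem_mPrime (neg_ne_zero.mpr hne), ?_⟩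
    rw [add_comm, pair_add_eq_cons_cons, neg_neg, cons_add, add_cons, Multiset.add_comm t (s - t),
      Multiset.sub_add_cancel ht.1]

/-- The per-tuple test is sound on a Hodge survivor. [cite: Shioda1979HodgeFermat, §4 condition (Qⁿₘ), p. 183] -/
theorem stably_of_qtestB {N : ℕ} [NeZero N] {T : List (List ℕ × List (List ℕ) × List (List ℕ))} {a b c d e : ℕ}
    (hs : IsHodgeMultiset (sext N a b c d e)) (h : qtestB N T a b c d e = true) :
    ∃ ξ₁ ∈ MPrime N, ∃ ξ₂ ∈ MPrime N, sext N a b c d e + ξ₂ = ξ₁ := by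
  unfold qtestB at h
  rw [Bool.or_eq_true] at h
  rcases h with h | h
  · exact stably_of_witness hs (by simp [sext]) (by unfold restB6 at h; exact h)
  · exact stably_of_lookupB h

/-! ### The unit group preserves `M'_N` -/

/-- `u · M'_N ⊂ M'_N`: units map pairs, Hodge `4`-sets and semi-decomposable sextuples to the same. [cite: Shioda1979HodgeFermat, §4, p. 183] -/
theorem map_unit_mem_mPrime {N : ℕ} [NeZero N] (u : (ZMod N)ˣ) {ξ : Multiset (ZMod N)} (h : ξ ∈ MPrime N) :
    ξ.map (fun a ↦ (u : ZMod N) * a) ∈ MPrime N := by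
  induction h using AddSubmonoid.closure_induction with
  | mem x hx =>
    refine mem_mPrime_of_mem ⟨isHodgeMultiset_map_unit u hx.1, ?_⟩
    rcases hx.2 with h2 | h4 | ⟨h6, hsd⟩
    · exact Or.inl (by rw [card_map, h2])
    · exact Or.inr (Or.inl (by rw [card_map, h4]))
    · exact Or.inr (Or.inr ⟨by rw [card_map, h6], isSemiDecomposable_map_unit u hsd⟩)
  | zero => simp
  | add x y _ _ hx hy => rw [Multiset.map_add]; exact (MPrime N).add_mem hx hy

/-- "Stably in `M'_N`" is invariant under the unit group. [cite: Shioda1979HodgeFermat, §4, p. 183] -/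
theorem stably_map_unit {N : ℕ} [NeZero N] (u : (ZMod N)ˣ) {s : Multiset (ZMod N)}
    (h : ∃ ξ₁ ∈ MPrime N, ∃ ξ₂ ∈ MPrime N, s + ξ₂ = ξ₁) :
    ∃ ξ₁ ∈ MPrime N, ∃ ξ₂ ∈ MPrime N, s.map (fun a ↦ (u : ZMod N) * a) + ξ₂ = ξ₁ := by
  obtain ⟨ξ₁, h₁, ξ₂, h₂, heq⟩ := h
  refine ⟨_, map_unit_mem_mPrime u h₁, _, map_unit_mem_mPrime u h₂, ?_⟩
  rw [← Multiset.map_add, heq]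

/-! ### The two searches -/

/-- Case U (the sextuple contains `1`): sorted `b ≤ c ≤ d ≤ e ≤ f` with `1 + b + ⋯ + f = 3N`, `b ∈ [b₀, b₀ + len)`; every tuple fails
the Hodge test or passes `qtestB`. [cite: Shioda1979HodgeFermat, §4 condition (Qⁿₘ), n = 4] -/
def checkQU (N : ℕ) (T : List (List ℕ × List (List ℕ) × List (List ℕ))) (b0 len : ℕ) : Bool :=
  (List.range' b0 len).all fun b ↦ (List.range' b (N - b)).all fun c ↦ (List.range' c (N - c)).all fun d ↦
    (List.range' (eLo N (1 + b + c + d) d) (eHi N (1 + b + c + d) + 1 - eLo N (1 + b + c + d) d)).all fun e ↦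
      (!(hodgeB6 N 1 b c d e (3 * N - (1 + b + c + d + e))) || qtestB N T 1 b c d e)

/-- Case N (no unit entry): sorted sextuples of non-units `a ≤ ⋯ ≤ f`, `Σ = 3N`, first representative `a ∈ [a₀, a₀ + len)`; every
tuple has a unit fifth entry (then it is not of this case), fails the Hodge test, or passes `qtestB`.
[cite: Shioda1979HodgeFermat, §4 condition (Qⁿₘ), n = 4] -/
def checkQN (N : ℕ) (T : List (List ℕ × List (List ℕ) × List (List ℕ))) (a0 len : ℕ) : Bool :=
  ((nonunits N).filter fun a ↦ a0 ≤ a ∧ a < a0 + len).all fun a ↦ ((nonunits N).filter (a ≤ ·)).all fun b ↦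
    ((nonunits N).filter (b ≤ ·)).all fun c ↦ ((nonunits N).filter (c ≤ ·)).all fun d ↦
      (List.range' (eLo N (a + b + c + d) d) (eHi N (a + b + c + d) + 1 - eLo N (a + b + c + d) d)).all fun e ↦
        (Nat.gcd e N == 1) || (!(hodgeB6 N a b c d e (3 * N - (a + b + c + d + e))) || qtestB N T a b c d e)

/-- Unpacking `checkQU`. [folklore] -/
theorem qtestB_of_checkQU {N : ℕ} {T : List (List ℕ × List (List ℕ) × List (List ℕ))} {b0 len : ℕ} (h : checkQU N T b0 len = true)
    {b c d e : ℕ} (hb0 : b0 ≤ b) (hb1 : b < b0 + len) (hbc : b ≤ c) (hc : c < N) (hcd : c ≤ d) (hd : d < N)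
    (hde : d ≤ e) (hef : e ≤ 3 * N - (1 + b + c + d + e)) (hf : 3 * N - (1 + b + c + d + e) < N)
    (hsum : 1 + b + c + d + e ≤ 3 * N) (hh : hodgeB6 N 1 b c d e (3 * N - (1 + b + c + d + e)) = true) :
    qtestB N T 1 b c d e = true := by
  unfold checkQU at h
  rw [List.all_eq_true] at h
  have h2 := h b (List.mem_range'_1.mpr ⟨hb0, hb1⟩)
  rw [List.all_eq_true] at h2
  have h3 := h2 c (List.mem_range'_1.mpr ⟨hbc, by omega⟩)
  rw [List.all_eq_true] at h3
  have h4 := h3 d (List.mem_range'_1.mpr ⟨hcd, by omega⟩)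
  rw [List.all_eq_true] at h4
  have hlo : eLo N (1 + b + c + d) d ≤ e := by unfold eLo; omega
  have hhi : e ≤ eHi N (1 + b + c + d) := by unfold eHi; omega
  have h5 := h4 e (List.mem_range'_1.mpr ⟨hlo, by omega⟩)
  simpa [hh] using h5

/-- Unpacking `checkQN`. [folklore] -/
theorem qtestB_of_checkQN {N : ℕ} {T : List (List ℕ × List (List ℕ) × List (List ℕ))} {a0 len : ℕ} (h : checkQN N T a0 len = true)
    {a b c d e : ℕ} (ha0 : a0 ≤ a) (ha1 : a < a0 + len)
    (ha : a ∈ nonunits N) (hb : b ∈ nonunits N) (hc : c ∈ nonunits N) (hd : d ∈ nonunits N) (he : Nat.gcd e N ≠ 1)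
    (hab : a ≤ b) (hbc : b ≤ c) (hcd : c ≤ d) (hde : d ≤ e) (hef : e ≤ 3 * N - (a + b + c + d + e))
    (hf : 3 * N - (a + b + c + d + e) < N) (hsum : a + b + c + d + e ≤ 3 * N)
    (hh : hodgeB6 N a b c d e (3 * N - (a + b + c + d + e)) = true) :
    qtestB N T a b c d e = true := by
  unfold checkQN at h
  rw [List.all_eq_true] at h
  have h1 := h a (List.mem_filter.mpr ⟨ha, by simpa using And.intro ha0 ha1⟩)
  rw [List.all_eq_true] at h1
  have h2 := h1 b (List.mem_filter.mpr ⟨hb, by simpa using hab⟩)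
  rw [List.all_eq_true] at h2
  have h3 := h2 c (List.mem_filter.mpr ⟨hc, by simpa using hbc⟩)
  rw [List.all_eq_true] at h3
  have h4 := h3 d (List.mem_filter.mpr ⟨hd, by simpa using hcd⟩)
  rw [List.all_eq_true] at h4
  have hlo : eLo N (a + b + c + d) d ≤ e := by unfold eLo; omega
  have hhi : e ≤ eHi N (a + b + c + d) := by unfold eHi; omega
  have h5 := h4 e (List.mem_range'_1.mpr ⟨hlo, by omega⟩)
  have hne : (Nat.gcd e N == 1) = false := by simpa using he
  simpa [hh, hne] using h5

/-! ### Soundness of the searches, sorted form -/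

/-- **Case U, sorted form**: chunks of `b` covering `[1, N)` that pass `checkQU` put every Hodge sextuple `{1, b, c, d, e, f}` listed
by increasing representatives stably in `M'_N`. [cite: Shioda1979HodgeFermat, §4 condition (Qⁿₘ), n = 4] -/
theorem qU_of_chunks (N : ℕ) [NeZero N] [Fact (1 < N)] (T : List (List ℕ × List (List ℕ) × List (List ℕ))) (chunks : List (ℕ × ℕ))
    (hcov : ∀ b, 0 < b → b < N → ∃ p ∈ chunks, p.1 ≤ b ∧ b < p.1 + p.2)
    (hs : ∀ p ∈ chunks, checkQU N T p.1 p.2 = true)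
    (b c d e : ZMod N) (hbc : b.val ≤ c.val) (hcd : c.val ≤ d.val) (hde : d.val ≤ e.val)
    (hef : e.val ≤ (-(1 + b + c + d + e)).val) (hH : IsHodgeMultiset ({1, b, c, d, e, -(1 + b + c + d + e)} : Multiset (ZMod N))) :
    ∃ ξ₁ ∈ MPrime N, ∃ ξ₂ ∈ MPrime N, ({1, b, c, d, e, -(1 + b + c + d + e)} : Multiset (ZMod N)) + ξ₂ = ξ₁ := by
  have h1 : (1 : ZMod N).val = 1 := ZMod.val_one N
  have hb := ZMod.val_lt b
  have hc := ZMod.val_lt c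
  have hd := ZMod.val_lt d
  have hflt := ZMod.val_lt (-(1 + b + c + d + e))
  have hsum := sum_val_eq_of_isHodgeMultiset_six hH
  rw [h1] at hsum
  have hfv : (-(1 + b + c + d + e)).val = 3 * N - (1 + b.val + c.val + d.val + e.val) := by omega
  have hh := hodgeB6_of_isHodgeMultiset hH
  rw [h1, hfv] at hh
  rw [hfv] at hef hflt
  have hb0 : b ≠ 0 := hH.1.1 b (by simp)
  have hbpos : 0 < b.val := by
    rcases Nat.eq_zero_or_pos b.val with h0 | h0
    · exact absurd ((ZMod.val_eq_zero b).mp h0) hb0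
    · exact h0
  obtain ⟨p, hp, hp0, hp1⟩ := hcov b.val hbpos hb
  have hr := qtestB_of_checkQU (hs p hp) hp0 hp1 hbc hc hcd hd hde hef hflt (by omega) hh
  have hsx : sext N 1 b.val c.val d.val e.val = {1, b, c, d, e, -(1 + b + c + d + e)} := sext_one_val b c d e
  rw [← hsx] at hH ⊢
  exact stably_of_qtestB hH hr

/-- **Case N, sorted form**: chunks of `a` covering `[1, N)` that pass `checkQN` put every Hodge sextuple of non-units listed by
increasing representatives stably in `M'_N`. [cite: Shioda1979HodgeFermat, §4 condition (Qⁿₘ), n = 4] -/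
theorem qN_of_chunks (N : ℕ) [NeZero N] (T : List (List ℕ × List (List ℕ) × List (List ℕ))) (chunks : List (ℕ × ℕ))
    (hcov : ∀ a, 0 < a → a < N → ∃ p ∈ chunks, p.1 ≤ a ∧ a < p.1 + p.2)
    (hs : ∀ p ∈ chunks, checkQN N T p.1 p.2 = true)
    (a b c d e : ZMod N) (hab : a.val ≤ b.val) (hbc : b.val ≤ c.val) (hcd : c.val ≤ d.val) (hde : d.val ≤ e.val)
    (hef : e.val ≤ (-(a + b + c + d + e)).val)
    (hua : ¬ IsUnit a) (hub : ¬ IsUnit b) (huc : ¬ IsUnit c) (hud : ¬ IsUnit d) (hue : ¬ IsUnit e)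
    (hH : IsHodgeMultiset ({a, b, c, d, e, -(a + b + c + d + e)} : Multiset (ZMod N))) :
    ∃ ξ₁ ∈ MPrime N, ∃ ξ₂ ∈ MPrime N, ({a, b, c, d, e, -(a + b + c + d + e)} : Multiset (ZMod N)) + ξ₂ = ξ₁ := by
  have ha := ZMod.val_lt a
  have hflt := ZMod.val_lt (-(a + b + c + d + e))
  have hsum := sum_val_eq_of_isHodgeMultiset_six hH
  have hfv : (-(a + b + c + d + e)).val = 3 * N - (a.val + b.val + c.val + d.val + e.val) := by omega
  have hh := hodgeB6_of_isHodgeMultiset hH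
  rw [hfv] at hh hef hflt
  have ha0 : a ≠ 0 := hH.1.1 a (by simp)
  have hapos : 0 < a.val := by
    rcases Nat.eq_zero_or_pos a.val with h0 | h0
    · exact absurd ((ZMod.val_eq_zero a).mp h0) ha0
    · exact h0
  have hma := val_mem_nonunits ha0 hua
  have hmb := val_mem_nonunits (hH.1.1 b (by simp)) hub
  have hmc := val_mem_nonunits (hH.1.1 c (by simp)) huc
  have hmd := val_mem_nonunits (hH.1.1 d (by simp)) hud
  have hme : Nat.gcd e.val N ≠ 1 := (mem_nonunits.mp (val_mem_nonunits (hH.1.1 e (by simp)) hue)).2.2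
  obtain ⟨p, hp, hp0, hp1⟩ := hcov a.val hapos ha
  have hr := qtestB_of_checkQN (hs p hp) hp0 hp1 hma hmb hmc hmd hme hab hbc hcd hde hef hflt (by omega) hh
  have hsx : sext N a.val b.val c.val d.val e.val = {a, b, c, d, e, -(a + b + c + d + e)} := sext_val a b c d e
  rw [← hsx] at hH ⊢
  exact stably_of_qtestB hH hr

end Summit.HodgeConjecture.FermatCycles.ConditionQFourfold
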